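import Summits.Ventures.HodgeRepro2.T5RecordSatakeCell
import Summits.Ventures.HodgeRepro2.T5HeckeRecurrenceTransport
import Summits.Ventures.HodgeRepro2.T5InertDegreeAdicCompletion

/-!
# The tree recursion of the record's spherical Hecke algebra: `T₁ T_{n+1} = T_{n+2} + (q − 1) T_{n+1} + q⁴ Tₙ`

Tier-5 support N3 / §G-N4.2 (seat p3, gen 77). Rows 6–9 / 9′ of T5-SATAKE-KERNEL-p3.md — the three-term
recurrence of the cell operators and its structure constants `q − 1`, `q⁴`, `q⁴ + q` with `q = N(v)` — are theorems
on `H(U(J₃(u₀)), K_U)` (files 189–192, 203) and on the completions (file 207). This file reads them on the RECORD'S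
OWN PAIR: the cells `aₙ = diag(ϖⁿ, 1, ϖ⁻ⁿ)` become `gₙ ∈ U(1 ⊗ H)` with image `P aₙ P⁻¹` in `U(H_w)` (`P` the
integral change of basis of seat p8's T5-145), their double-coset operators `Tₙ := 1_{K_v gₙ K_v}` satisfy

  `T₁ · T_{n+2} = T_{n+3} + (N(v) − 1) T_{n+2} + N(v)⁴ T_{n+1}`,  `T₁ · T₁ = T₂ + (N(v) − 1) T₁ + (N(v)⁴ + N(v)) T₀`

— file 207's identities carried by the algebra isomorphism of file 232 (`ε`, the cast, `recordHeckeEquiv⁻¹`) through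
file 246's `composite_doubleCosetOp` (the images of the cells) and `three_term_of_map` (the relation):

* **`exists_cells_three_term_record`** — under file 232's hypotheses and `e(w/v) = 1`, `k` of characteristic `0`.

§8(d): uses an L-value-free non-vanishing device: NO.
-/

open Matrix NumberField NumberField.IsCMField IsDedekindDomain IsDedekindDomain.HeightOneSpectrum Module Polynomial
  MulAction
open scoped TensorProduct Pointwise
open Summit.Ventures.HodgeRepro2.T5UnitaryGroupForm Summit.Ventures.HodgeRepro2.T5UnitaryHeckeAdjoint
  Summit.Ventures.HodgeRepro2.T5HeckePermutationModule Summit.Ventures.HodgeRepro2.T5StarOfInvolution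
  Summit.Ventures.HodgeRepro2.T5FinitePlaceCM Summit.Ventures.HodgeRepro2.T5FinitePlaceNormIndex
  Summit.Ventures.HodgeRepro2.T5NonSplitPlaceUnitaryGroup Summit.Ventures.HodgeRepro2.T5RecordHyperspecial
  Summit.Ventures.HodgeRepro2.T5GlobalLatticeAlmostAll Summit.Ventures.HodgeRepro2.T5HermitianLocalIsotropyN3
  Summit.Ventures.HodgeRepro2.T5FinitePlaceSplitClassification Summit.Ventures.HodgeRepro2.T5HermitianThreeElements
  Summit.Ventures.HodgeRepro2.T5GaloisCartanThree Summit.Ventures.HodgeRepro2.T5InertDegreeGalois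
  Summit.Ventures.HodgeRepro2.T5InertDegreeCompletion Summit.Ventures.HodgeRepro2.T5InertPlaceCompletion
  Summit.Ventures.HodgeRepro2.T5InertDegreeAdicCompletion Summit.Ventures.HodgeRepro2.T5InertSatakeTransform
  Summit.Ventures.HodgeRepro2.T5InertPlaceCompletionCells Summit.Ventures.HodgeRepro2.T5InertTopCoefficient
  Summit.Ventures.HodgeRepro2.T5SplitUnitaryGroupEquiv Summit.Ventures.HodgeRepro2.T5HeckeBasisCells
  Summit.Ventures.HodgeRepro2.T5HeckeDoubleCoset Summit.Ventures.HodgeRepro2.T5InertHeckeCells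
  Summit.Ventures.HodgeRepro2.T5HeckeGeneratorTransport Summit.Ventures.HodgeRepro2.T5RecordSatake
  Summit.Ventures.HodgeRepro2.T5CartanCellsDistinct Summit.Ventures.HodgeRepro2.T5HeckeIsomorphismTransport
  Summit.Ventures.HodgeRepro2.T5HeckeIsomorphismTransportCells Summit.Ventures.HodgeRepro2.T5SplitPlaceUnitaryGroup
  Summit.Ventures.HodgeRepro2.T5HeckeRecurrenceTransport Summit.Ventures.HodgeRepro2.T5RecordSatakeCell

namespace Summit.Ventures.HodgeRepro2.T5RecordSatakeRecurrence

section Record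

variable (K : Type*) [Field K] [NumberField K] [IsCMField K]
variable (v : HeightOneSpectrum (𝓞 (maximalRealSubfield K))) (w : HeightOneSpectrum (𝓞 K))
  [w.asIdeal.LiesOver v.asIdeal]
  [IsDiscreteValuationRing (integralClosure (v.adicCompletionIntegers (maximalRealSubfield K)) (w.adicCompletion K))]
  [Finite (IsLocalRing.ResidueField (integralClosure (v.adicCompletionIntegers (maximalRealSubfield K))
    (w.adicCompletion K)))]
  [IsFractionRing (integralClosure (v.adicCompletionIntegers (maximalRealSubfield K)) (w.adicCompletion K))
    (w.adicCompletion K)]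
variable {θ : maximalRealSubfield K} {y : K}
  (hθ : algebraMap (maximalRealSubfield K) K θ = y ^ 2) (hy : complexConj K y ≠ y)
  (hsq : ¬ IsSquare (algebraMap (maximalRealSubfield K) (v.adicCompletion (maximalRealSubfield K)) θ))
  {ϖ : v.adicCompletionIntegers (maximalRealSubfield K)} (hϖ : Irreducible ϖ)
  (hinert : Irreducible (algebraMap (v.adicCompletionIntegers (maximalRealSubfield K)) (w.adicCompletionIntegers K) ϖ))
variable {r : ℕ} (l : Fin r → 𝓞 K)

include hθ hy hsq hϖ hinert in
/-- **THE TREE RECURSION ON THE RECORD'S OWN PAIR**: there are `u₀ ∈ 𝒪_{K⁺_v}ˣ`, an integral change of basis `P`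
with `Pᴴ H_w P = J₃(u₀)`, and cells `gₙ ∈ U(1 ⊗ H)` with image `P · cell(ϖ, n) · P⁻¹` in `U(H_w)`
(`cell(ϖ, n) = diag(ϖⁿ, 1, ϖ⁻ⁿ)`), whose double cosets are finite and whose characteristic functions
`Tₙ = 1_{K_v gₙ K_v}` satisfy `T₁ T_{n+2} = T_{n+3} + (N(v) − 1) T_{n+2} + N(v)⁴ T_{n+1}` and
`T₁ T₁ = T₂ + (N(v) − 1) T₁ + (N(v)⁴ + N(v)) T₀` in `H(U(1 ⊗ H), K_v)` — rows 6–9 / 9′ of the Satake memo as printed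
on the record's pair (file 207 transported by file 246). -/
theorem exists_cells_three_term_record (k : Type*) [Field k] [CharZero k]
    (hl : Submodule.span (𝓞 (maximalRealSubfield K)) (Set.range l) = ⊤)
    (he : v.asIdeal.ramificationIdx' w.asIdeal = 1)
    {H : Matrix (Fin 3) (Fin 3) K} (hH : H.IsHermitian) (hdet : IsUnit H.det) (hgood : w ∉ badSet H) :
    letI := tensorStarRing K v
    letI := starRingOfQuadratic (finrank_eq_two K v w hθ hy hsq)
      (localConj v w hθ.symm (span_pair_eq_top K hy) hsq (complexConj K))
      (localConj_ne_one v w hθ.symm (span_pair_eq_top K hy) hsq (complexConj K)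
        (complexConj_apply_eq_neg K hθ hy))
    ∃ (u₀ : (v.adicCompletionIntegers (maximalRealSubfield K))ˣ) (P : GL (Fin 3) (w.adicCompletion K))
      (g : ℕ → ↥(formUnitaryGroup (tensorGram K v H))),
      P ∈ (Matrix.GeneralLinearGroup.map (algebraMap
        (integralClosure (v.adicCompletionIntegers (maximalRealSubfield K)) (w.adicCompletion K))
        (w.adicCompletion K))).range ∧
      (P : Matrix (Fin 3) (Fin 3) (w.adicCompletion K))ᴴ * H.map (algebraMap K (w.adicCompletion K)) * P =
        J3 (algebraMap (v.adicCompletionIntegers (maximalRealSubfield K)) (w.adicCompletion K)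
          (u₀ : v.adicCompletionIntegers (maximalRealSubfield K))) ∧
      (∀ n, ((recordNonSplitEquiv' K v w hθ hy hsq H (g n) :
          ↥(formUnitaryGroup (H.map (algebraMap K (w.adicCompletion K))))) : GL (Fin 3) (w.adicCompletion K)) =
        P * cell (irreducible_uniformiser (map_maximalIdeal_integralClosure_eq_of_irreducible v w hϖ hinert) hϖ) n
          * P⁻¹) ∧
      ∃ hfin : ∀ n, Finite (orbit (recordHyperspecial K v l H) (g n : _ ⧸ recordHyperspecial K v l H)),
        (∀ n, letI := hfin 1; letI := hfin (n + 1 + 1); letI := hfin (n + 1 + 1 + 1); letI := hfin (n + 1);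
          doubleCosetOp k (recordHyperspecial K v l H) (g 1) *
              doubleCosetOp k (recordHyperspecial K v l H) (g (n + 1 + 1)) =
            doubleCosetOp k (recordHyperspecial K v l H) (g (n + 1 + 1 + 1)) +
              ((Ideal.absNorm v.asIdeal : k) - 1) • doubleCosetOp k (recordHyperspecial K v l H) (g (n + 1 + 1)) +
              (Ideal.absNorm v.asIdeal : k) ^ 4 • doubleCosetOp k (recordHyperspecial K v l H) (g (n + 1))) ∧
        (letI := hfin 1; letI := hfin (0 + 1); letI := hfin (0 + 1 + 1); letI := hfin 0;
          doubleCosetOp k (recordHyperspecial K v l H) (g 1) *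
              doubleCosetOp k (recordHyperspecial K v l H) (g (0 + 1)) =
            doubleCosetOp k (recordHyperspecial K v l H) (g (0 + 1 + 1)) +
              ((Ideal.absNorm v.asIdeal : k) - 1) • doubleCosetOp k (recordHyperspecial K v l H) (g (0 + 1)) +
              ((Ideal.absNorm v.asIdeal : k) ^ 4 + Ideal.absNorm v.asIdeal) •
                doubleCosetOp k (recordHyperspecial K v l H) (g 0)) := by
  letI := tensorStarRing K v
  letI := starRingOfQuadratic (finrank_eq_two K v w hθ hy hsq)
    (localConj v w hθ.symm (span_pair_eq_top K hy) hsq (complexConj K))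
    (localConj_ne_one v w hθ.symm (span_pair_eq_top K hy) hsq (complexConj K)
      (complexConj_apply_eq_neg K hθ hy))
  -- the local data (as in file 232)
  have hst : ∀ x : w.adicCompletion K,
      star x = localConj v w hθ.symm (span_pair_eq_top K hy) hsq (complexConj K) x := fun x => by
    rw [star_p8_eq_star K v w hθ hy hsq]
    rfl
  have hHw := isHermitian_map_p8 K v w hθ hy hsq hH
  have hdetw : IsUnit (H.map (algebraMap K (w.adicCompletion K))).det := isUnit_det_map _ H hdet
  have hint : ∀ i j, IsLocalization.IsInteger
      (integralClosure (v.adicCompletionIntegers (maximalRealSubfield K)) (w.adicCompletion K))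
      ((H.map (algebraMap K (w.adicCompletion K))) i j) := fun i j => by
    rw [isInteger_integralClosure_iff_of_isIntegralClosure (A := w.adicCompletionIntegers K), Matrix.map_apply]
    exact isInteger_of_notMem_badSet hgood i j
  have hint' : ∀ i j, IsLocalization.IsInteger
      (integralClosure (v.adicCompletionIntegers (maximalRealSubfield K)) (w.adicCompletion K))
      ((H.map (algebraMap K (w.adicCompletion K)))⁻¹ i j) := fun i j => by
    rw [isInteger_integralClosure_iff_of_isIntegralClosure (A := w.adicCompletionIntegers K), inv_map _ H hdet,
      Matrix.map_apply]
    exact isInteger_inv_of_notMem_badSet hgood i j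
  have h3 : 2 < Fintype.card (Fin 3) := by rw [Fintype.card_fin]; norm_num
  have hiso := exists_sesqForm_eq_zero_localConj v w hθ.symm (span_pair_eq_top K hy) hsq (complexConj K)
    (complexConj_apply_eq_neg K hθ hy) (finrank_eq_two K v w hθ hy hsq) (ι := Fin 3) h3
    (H := H.map (algebraMap K (w.adicCompletion K))) hHw hdetw
  obtain ⟨x, hx0, hx⟩ := hiso
  -- the two spellings of `K_{H_w}`
  have hK : hyperspecialSubgroup (integralClosure (v.adicCompletionIntegers (maximalRealSubfield K))
      (w.adicCompletion K)) (H.map (algebraMap K (w.adicCompletion K))) =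
      hyperspecialSubgroup (w.adicCompletionIntegers K) (H.map (algebraMap K (w.adicCompletion K))) :=
    hyperspecialSubgroup_integralClosure_eq (R := v.adicCompletionIntegers (maximalRealSubfield K))
      (A := w.adicCompletionIntegers K) _
  -- seat p8's T5-145 on the completions: the change of basis `P`, the unit `u₀`, the transport `ε`
  refine (exists_algEquiv_doubleCosetOp_of_isotropic_of_unramified
    (v.adicCompletionIntegers (maximalRealSubfield K)) (v.adicCompletion (maximalRealSubfield K))
    (w.adicCompletion K) (finrank_eq_two K v w hθ hy hsq)
    (localConj v w hθ.symm (span_pair_eq_top K hy) hsq (complexConj K))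
    (localConj_ne_one v w hθ.symm (span_pair_eq_top K hy) hsq (complexConj K) (complexConj_apply_eq_neg K hθ hy))
    (map_maximalIdeal_integralClosure_eq_of_irreducible v w hϖ hinert)
    (H.map (algebraMap K (w.adicCompletion K))) k hHw hint hdetw hint' x hx0 hx).elim fun u₀ h1 =>
    h1.elim fun P h2 => h2.2.2.elim fun ε hε => ?_
  have hP := h2.1
  have hPHP := h2.2.1
  -- the cells `aₙ` of `U(J₃(u₀))` and their conjugates `bₙ = P aₙ P⁻¹ ∈ U(H_w)`
  have hϖ' := irreducible_uniformiser (map_maximalIdeal_integralClosure_eq_of_irreducible v w hϖ hinert) hϖ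
  have hs := star_algebraMap_of_star_eq (localConj v w hθ.symm (span_pair_eq_top K hy) hsq (complexConj K)) hst ϖ
  have hbex : ∀ n, ∃ b : ↥(formUnitaryGroup (H.map (algebraMap K (w.adicCompletion K)))),
      (b : GL (Fin 3) (w.adicCompletion K)) = P * (cellU hϖ' hs (algebraMap (v.adicCompletionIntegers
        (maximalRealSubfield K)) (w.adicCompletion K) (u₀ : v.adicCompletionIntegers (maximalRealSubfield K))) n :
        GL (Fin 3) (w.adicCompletion K)) * P⁻¹ :=
    fun n => ⟨⟨_, conj_mem_formUnitaryGroup P hPHP (cellU hϖ' hs _ n).2⟩, rfl⟩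
  choose b hb using hbex
  have hKφ := mem_recordHyperspecial_iff_nonSplit K v w hθ hy hsq l hl H
  -- the finiteness of every double coset, on each of the four groups (types inferred from `finite_orbit`)
  have hA := fun n => finite_orbit (R := integralClosure (v.adicCompletionIntegers (maximalRealSubfield K))
    (w.adicCompletion K)) (J3 (algebraMap (v.adicCompletionIntegers (maximalRealSubfield K))
    (w.adicCompletion K) (u₀ : v.adicCompletionIntegers (maximalRealSubfield K))))
    (cellU hϖ' hs (algebraMap (v.adicCompletionIntegers (maximalRealSubfield K)) (w.adicCompletion K)
      (u₀ : v.adicCompletionIntegers (maximalRealSubfield K))) n)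
  have hB := fun n => finite_orbit (R := integralClosure (v.adicCompletionIntegers (maximalRealSubfield K))
    (w.adicCompletion K)) (H.map (algebraMap K (w.adicCompletion K))) (b n)
  have hB' := fun n => finite_orbit (R := w.adicCompletionIntegers K) (H.map (algebraMap K (w.adicCompletion K)))
    (b n)
  have hB'' := fun n => finite_orbit (R := w.adicCompletionIntegers K) (H.map (algebraMap K (w.adicCompletion K)))
    (recordNonSplitEquiv' K v w hθ hy hsq H ((recordNonSplitEquiv' K v w hθ hy hsq H).symm (b n)))
  have hC := fun n => @finite_orbit_of_mulEquiv _ _ _ _ (recordNonSplitEquiv' K v w hθ hy hsq H) _ _ hKφ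
    ((recordNonSplitEquiv' K v w hθ hy hsq H).symm (b n)) (hB'' n)
  -- seat p8's `ε(T_{aₙ}) = T_{bₙ}`
  have hE₁ := fun n => @hε (cellU hϖ' hs (algebraMap (v.adicCompletionIntegers (maximalRealSubfield K))
    (w.adicCompletion K) (u₀ : v.adicCompletionIntegers (maximalRealSubfield K))) n) (b n) (hb n) (hA n) (hB n)
  -- the composite isomorphism of file 232 sends `T_{aₙ}` to `T_{gₙ}`
  have hE := composite_doubleCosetOp k ε hK (recordNonSplitEquiv' K v w hθ hy hsq H) hKφ _ b hA hB hB' hB'' hC hE₁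
  have hEt : ∀ n, (ε.trans ((hK ▸ AlgEquiv.refl : heckeAlgebra k (hyperspecialSubgroup (integralClosure
      (v.adicCompletionIntegers (maximalRealSubfield K)) (w.adicCompletion K))
      (H.map (algebraMap K (w.adicCompletion K)))) ≃ₐ[k] heckeAlgebra k (hyperspecialSubgroup
      (w.adicCompletionIntegers K) (H.map (algebraMap K (w.adicCompletion K))))).trans
      (heckeAlgebraEquivOfMulEquiv k (recordNonSplitEquiv' K v w hθ hy hsq H) hKφ).symm))
      (heckeBasisCells (R := integralClosure (v.adicCompletionIntegers (maximalRealSubfield K)) (w.adicCompletion K))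
        (hstar_of_star_eq (localConj v w hθ.symm (span_pair_eq_top K hy) hsq (complexConj K)) hst)
        (algebraMap (v.adicCompletionIntegers (maximalRealSubfield K)) (w.adicCompletion K)
          (u₀ : v.adicCompletionIntegers (maximalRealSubfield K)))
        (star_algebraMap_of_star_eq (localConj v w hθ.symm (span_pair_eq_top K hy) hsq (complexConj K)) hst _)
        (algebraMap_unit_ne_zero (F := v.adicCompletion (maximalRealSubfield K)) u₀)
        (isInteger_algebraMap (u₀ : v.adicCompletionIntegers (maximalRealSubfield K)))
        (isInteger_algebraMap_unit_inv u₀) hϖ' hs k n) =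
      @doubleCosetOp _ _ k _ (recordHyperspecial K v l H)
        ((recordNonSplitEquiv' K v w hθ hy hsq H).symm (b n)) (hC n) := fun n =>
    (congrArg _ (heckeBasisCells_apply _ _ _ _ _ _ hϖ' hs k n)).trans (hE n)
  -- file 207's identities, carried by `three_term_of_map`
  have hrec := fun n => three_term_of_map _ _ _ hEt (mul_cellU_eq_adicCompletion v w
    (localConj v w hθ.symm (span_pair_eq_top K hy) hsq (complexConj K)) hst he (finrank_eq_two K v w hθ hy hsq)
    (localConj_ne_one v w hθ.symm (span_pair_eq_top K hy) hsq (complexConj K) (complexConj_apply_eq_neg K hθ hy))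
    hϖ hinert k u₀ n)
  have hrec0 := three_term_of_map _ _ _ hEt (mul_cellU_one_eq_adicCompletion v w
    (localConj v w hθ.symm (span_pair_eq_top K hy) hsq (complexConj K)) hst he (finrank_eq_two K v w hθ hy hsq)
    (localConj_ne_one v w hθ.symm (span_pair_eq_top K hy) hsq (complexConj K) (complexConj_apply_eq_neg K hθ hy))
    hϖ hinert k u₀)
  refine ⟨u₀, P, fun n => (recordNonSplitEquiv' K v w hθ hy hsq H).symm (b n), hP, hPHP, ?_, hC, hrec, hrec0⟩
  intro n
  rw [MulEquiv.apply_symm_apply, hb n, coe_cellU]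

end Record

end Summit.Ventures.HodgeRepro2.T5RecordSatakeRecurrence
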